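import Summits.HodgeConjecture.HodgeConjecture.Theorems.VHCAbelianSchemesRoadDesignNecessary
import Literature.AlgebraicGeometry.HodgeTheory.CanonicalTrace
import Literature.AlgebraicGeometry.HodgeTheory.MixedEllipticCurvesProductsHodgeClasses
import HarnessLib

/-!
# Road b02 (`VHCAbelianSchemesRoad`) — THE `B`-FIELD IS INVISIBLE IN CODIMENSION TWO: the design problem modulo Lefschetz classes for the
# twisted door at `(n, 2)` is a statement about the UNTWISTED Chern character `ch₂` of an admissible complex of vector bundles

research route conditional on HC_CM; not a corollary; Q11.4-sentence-2 already refuted in dim ≥ 3.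

THEOREMS ONLY (no definition, no named fact, no sorry; `HC_CM` occurs nowhere). For the road's door
`twistedReflexiveClass C Adm` (a bounded complex of vector bundles `E•`, `Adm`-admissible, with a RATIONAL ALGEBRAIC `B`-field `B₀`,
`κ = exp(B₀) ∪ ch(E•)`) the degree-`2` class is `κ₂ = ch₂(E•) + B₀ ∪ ch₁(E•) + ½ B₀² ∪ ch₀(E•)`; on a smooth projective variety `B₀` and
`ch₁(E•)` are rational `(1,1)`-classes and `ch₀(E•) ∈ ℂ·1`, so the two correction terms are divisor monomials:

* §1 `expTwistClasses_two_sub_mem_divisorClassesSpan` — `(exp B ∪ κ)₂ − κ₂ ∈ D²(X) ⊗ ℂ` whenever `B`, `κ₁` are rational `(1,1)` and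
  `κ₀ ∈ ℂ·1`; `kappa_two_sub_chPerfect_mem_divisorClassesSpan` — for a member of `twistedReflexiveClass C Adm n X I κ` with `2 ∈ I` on a
  smooth projective `X`: `κ₂ − ch₂(E•) ∈ D²(X) ⊗ ℂ` for its complex `E•`.
* §2 **`exists_untwisted_of_designModLefschetzAt_two`** — `DesignModLefschetzAt (twistedReflexiveClass C Adm) n 2` delivers, for every
  `(X, w)` as there, an `Adm`-admissible bounded complex of vector bundles `E•` on a copy `e : X' ≅ X` with `ch₂(E•) = e^*(a·w + z')`, `a ≠ 0`,
  `z'` an algebraic LEFSCHETZ class — NO `B`-FIELD; hence (PART Z-c) so does the cell `LefAtExceptionalRegimeAt (twistedReflexiveClass C Adm) n 2`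
  (`exists_untwisted_of_lefAtExceptionalRegimeAt_two`), and for the road's `AdmTw` (gluable σ-semiregular complexes OR a single
  Buchweitz–Flenner-semiregular vector bundle in degree `0`) the `(4,2)` stub `stub_firstCell_fourfoldMiddleTw` demands, on a copy of EVERY
  abelian fourfold `X` with a rational algebraic `w ∉ D²(X) ⊗ ℂ`, such a complex (`exists_untwisted_of_firstCell_fourfoldMiddleTw`); KILL
  SWITCH `not_firstCell_fourfoldMiddleTw_of_no_untwisted` — the refuter's target at `(4,2)` is `B`-field-free: «no AdmTw-admissible `E•` on any
  copy of `X` with `ch₂(E•) ≡ a·w (mod D² ⊗ ℂ)`, `a ≠ 0`».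

* §3 (appended) EVERY DEGREE: `expTwistClasses_sub_mem_divisorClassesSpan` (`(exp B ∪ κ)_p ≡ κ_p (mod Dᵖ ⊗ ℂ)` when `κ_j ∈ Dʲ ⊗ ℂ` for `j < p`),
  `kappa_sub_chPerfect_mem_divisorClassesSpan` (for the door, under `Nʲ ⊆ Dʲ ⊗ ℂ` for `2 ≤ j < p`), `exists_untwisted_of_designModLefschetzAt_of_algebraicClasses_le`,
  and **`exists_untwisted_pinned_sixfold_of_rung_sixfoldMiddleTw`** — the `(6,3)` rung at a sixfold with `B¹ = ℚ·θ` and `N² ⊆ D² ⊗ ℂ` (a very general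
  Weil-type member; hypotheses here) and an algebraic `w ∉ ℂ·θ³` demands an UNTWISTED AdmTw-admissible complex with `ch₃(E•) = e^*(a·w + c·θ³)`.

Honest scope: the hypotheses `B¹ = ℚ·θ`, `N² ⊆ D² ⊗ ℂ` are displayed, never discharged here; nothing is claimed about any cell or design problem. References: [cite: HuybrechtsStellari2005, §1]
(twisted Chern character) [cite: Perry2026Semiregularity, Thm. 1.1] [cite: Fulton1998, Example 3.2.3 and §15.1] [cite: VoisinHodgeI2002,
Thm. 11.30] [cite: vanGeemen1994HodgeAV, §2.4 and Thm. 4.11] [cite: Bloch1972Semiregularity, Remark (7.5)].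
-/

noncomputable section

open CategoryTheory CategoryTheory.Limits AlgebraicGeometry Topology

-- the cell's namespace repeats the summit name (`Summit.HodgeConjecture.HodgeConjecture…`), as in every `Ring2*` file
set_option linter.dupNamespace false

namespace Summit.HodgeConjecture.HodgeConjecture.Ring2.SemiregularRepresentatives

open Literature.AlgebraicGeometry Literature.AlgebraicGeometry.Motives
open Literature.AlgebraicGeometry.HodgeTheory
open Literature.AlgebraicTopology.SingularHomology
open Literature.AlgebraicGeometry.KTheory (IsBoundedVBComplex)
open Literature.Barriers.HodgeConjecture (divisorClassesSpan divisorMonomials mem_divisorMonomials_succ)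
open Summit.Ventures.HSemireg (ObjClass)

/-! ## §1 `(exp B ∪ κ)₂ ≡ κ₂ (mod D² ⊗ ℂ)` -/

/-- **The degree-`2` twist correction is a divisor polynomial**: if `B` and `κ₁` are rational `(1,1)`-classes and `κ₀ = c·1`, then
`(exp B ∪ κ)₂ − κ₂ = B ∪ κ₁ + ½ B² ∪ κ₀ = B ∪ κ₁ + (c/2)·B²` lies in `D²(X) ⊗ ℂ`. [cite: HuybrechtsStellari2005, §1] [cite: vanGeemen1994HodgeAV, §2.4] -/
theorem expTwistClasses_two_sub_mem_divisorClassesSpan {N : ℕ} {X : SchemeOver ℂ} {B : complexBetti X 2}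
    (hBQ : IsRationalClass B) (hBH : IsOfHodgeType N X 2 1 1 B) {κ : (j : ℕ) → complexBetti X (2 * j)}
    (hκ1Q : IsRationalClass (κ 1)) (hκ1H : IsOfHodgeType N X 2 1 1 (κ 1))
    (hκ0 : κ 0 ∈ ℂ ∙ singularCohomology.one ℂ (ComplexPoints X)) :
    expTwistClasses X B κ 2 - κ 2 ∈ divisorClassesSpan X N 2 := by
  unfold expTwistClasses
  rw [Fin.sum_univ_succ]
  have h0 : ((Nat.factorial ((0 : Fin (2 + 1)) : ℕ) : ℕ) : ℂ)⁻¹ •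
      cupProduct (two_mul_add_two_mul_sub (0 : Fin (2 + 1)).2) (cupPowTwo B ((0 : Fin (2 + 1)) : ℕ))
        (κ (2 - ((0 : Fin (2 + 1)) : ℕ))) = κ 2 := by
    show ((Nat.factorial 0 : ℕ) : ℂ)⁻¹ • cupProduct _ (cupPowTwo B 0) (κ (2 - 0)) = κ 2
    rw [Nat.factorial_zero, Nat.cast_one, inv_one, one_smul, cupPowTwo_zero]
    exact one_cupProduct _
  rw [h0, add_sub_cancel_left]
  refine Submodule.sum_mem _ fun i _ ↦ Submodule.smul_mem _ _ ?_
  fin_cases i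
  · -- the term `B ∪ κ₁`
    show cupProduct _ (cupPowTwo B 1) (κ (2 - 1)) ∈ divisorClassesSpan X N 2
    exact Submodule.subset_span
      (mem_divisorMonomials_succ.2 ⟨_, cupPowTwo_mem_divisorMonomials hBQ hBH 1, κ 1, hκ1Q, hκ1H, rfl⟩)
  · -- the term `B² ∪ κ₀ = c • B²`
    show cupProduct _ (cupPowTwo B 2) (κ (2 - 2)) ∈ divisorClassesSpan X N 2
    obtain ⟨c, hc⟩ := Submodule.mem_span_singleton.1 hκ0
    have hκ0' : κ (2 - 2) = c • singularCohomology.one ℂ (ComplexPoints X) := hc.symm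
    rw [hκ0', LinearMap.map_smul]
    refine Submodule.smul_mem _ _ (Submodule.subset_span ?_)
    have h1 : cupProduct (two_mul_add_two_mul_sub (show ((2 : Fin (2 + 1)) : ℕ) < 2 + 1 by decide)) (cupPowTwo B 2)
        (singularCohomology.one ℂ (ComplexPoints X)) = cupPowTwo B 2 := cupProduct_one _
    rw [h1]
    exact cupPowTwo_mem_divisorMonomials hBQ hBH 2

/-- **For a member of the twisted door, `κ₂ ≡ ch₂(E•) (mod D² ⊗ ℂ)`**: on a smooth projective `X`, a datum
`twistedReflexiveClass C Adm n X I κ` with `2 ∈ I` has a bounded complex of vector bundles `E•`, `Adm`-admissible, with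
`κ₂ − ch₂(E•) ∈ D²(X) ⊗ ℂ` (`B₀` rational in `N¹`, `ch₁(E•)` rational in `N¹`, `ch₀(E•) ∈ H⁰ = ℂ·1`).
[cite: Perry2026Semiregularity, Thm. 1.1 (hypotheses)] [cite: Fulton1998, Example 3.2.3] [cite: VoisinHodgeI2002, Thm. 11.30] -/
theorem kappa_two_sub_chPerfect_mem_divisorClassesSpan {C : ChernCharacterBetti} {Adm : PerfectAdmissibility} {n N : ℕ}
    {X : SchemeOver ℂ} (hX : IsSmoothProjective N X) {I : Finset ℕ} {κ : (q : ℕ) → complexBetti X (2 * q)}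
    (h : twistedReflexiveClass C Adm n X I κ) (h2 : 2 ∈ I) :
    ∃ (E : CochainComplex X.left.Modules ℤ) (hE : IsBoundedVBComplex E),
      Adm n X I E ∧ κ 2 - chPerfect C X E hE.isFiniteLocallyFree 2 ∈ divisorClassesSpan X N 2 := by
  obtain ⟨E, hE, B₀, hAdm, hBQ, hBalg, hκ⟩ := h
  refine ⟨E, hE, hAdm, ?_⟩
  rw [hκ 2 h2]
  refine expTwistClasses_two_sub_mem_divisorClassesSpan hBQ
    (isOfHodgeType_of_mem_algebraicClasses_of_isSmoothProjective hX 1 hBalg)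
    (isRationalClass_chPerfect C X E hE.isFiniteLocallyFree 1)
    (isOfHodgeType_of_mem_algebraicClasses_of_isSmoothProjective hX 1
      (chPerfect_mem_algebraicClasses C X hX E hE.isFiniteLocallyFree 1)) ?_
  obtain ⟨c, hc⟩ := exists_eq_smul_one_of_isSmoothProjective hX ℂ (chPerfect C X E hE.isFiniteLocallyFree 0)
  exact Submodule.mem_span_singleton.2 ⟨c, hc.symm⟩

/-! ## §2 The design problem modulo Lefschetz classes at `(n, 2)` is `B`-field-free -/

/-- **`DesignModLefschetzAt (twistedReflexiveClass C Adm) n 2` in UNTWISTED form**: for every complex scheme `X` isomorphic to an abelian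
`n`-fold and every rational algebraic `w ∉ D²(X) ⊗ ℂ`, some copy `e : X' ≅ X` carries an `Adm`-admissible bounded complex of vector bundles `E•`
(admissible in some degrees `I ∋ 2`) with `ch₂(E•) = e^*(a·w + z')`, `a ≠ 0`, `z'` an algebraic Lefschetz class of `X` — the `B`-field is
absorbed into `z'` (§1 and `e⁻¹^*(D²(X') ⊗ ℂ) ⊆ D²(X) ⊗ ℂ`). [cite: HuybrechtsStellari2005, §1] [cite: vanGeemen1994HodgeAV, §2.4]
[cite: Bloch1972Semiregularity, Remark (7.5)] -/
theorem exists_untwisted_of_designModLefschetzAt_two {C : ChernCharacterBetti} {Adm : PerfectAdmissibility} {n : ℕ}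
    (h : DesignModLefschetzAt (twistedReflexiveClass C Adm) n 2) (X : SchemeOver ℂ)
    (hX : ∃ A : AbelianVariety ℂ, A.dim = n ∧ Nonempty (A.X ≅ X)) (w : complexBetti X (2 * 2)) (hwQ : IsRationalClass w)
    (hwalg : w ∈ algebraicClasses X 2) (hwD : w ∉ divisorClassesSpan X n 2) :
    ∃ (X' : SchemeOver ℂ) (e : X' ≅ X) (I : Finset ℕ) (E : CochainComplex X'.left.Modules ℤ) (hE : IsBoundedVBComplex E)
      (a : ℂ) (z' : complexBetti X (2 * 2)),
      2 ∈ I ∧ Adm n X' I E ∧ a ≠ 0 ∧ z' ∈ algebraicClasses X 2 ∧ z' ∈ divisorClassesSpan X n 2 ∧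
      chPerfect C X' E hE.isFiniteLocallyFree 2 = complexBetti.map e.hom (2 * 2) (a • w + z') := by
  obtain ⟨A, hA, ⟨eA⟩⟩ := hX
  have hAX : IsSmoothProjective n A.X := hA ▸ AbelianVariety.isSmoothProjective_holds (A := A)
  have hXsp : IsSmoothProjective n X := hAX.of_iso eA
  obtain ⟨X', e, I, κ, a, z, h2I, h𝒪, ha, hzalg, hzD, hκ2, -⟩ := h X ⟨A, hA, ⟨eA⟩⟩ w hwQ hwalg hwD
  have hX'sp : IsSmoothProjective n X' := hXsp.of_iso e.symm
  obtain ⟨E, hE, hAdm, hd⟩ := kappa_two_sub_chPerfect_mem_divisorClassesSpan hX'sp h𝒪 h2I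
  -- the correction `d := κ₂ − ch₂(E•) ∈ D²(X')`, moved to `X` along `e⁻¹`
  set d := κ 2 - chPerfect C X' E hE.isFiniteLocallyFree 2 with hd_def
  have hdX : complexBetti.map e.inv (2 * 2) d ∈ divisorClassesSpan X n 2 := map_mem_divisorClassesSpan hXsp hX'sp e.inv hd
  refine ⟨X', e, I, E, hE, a, z - complexBetti.map e.inv (2 * 2) d, h2I, hAdm, ha, ?_, Submodule.sub_mem _ hzD hdX, ?_⟩
  · exact Submodule.sub_mem _ hzalg (divisorClassesSpan_le_algebraicClasses_of_isSmoothProjective hXsp 2 hdX)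
  · have hch : chPerfect C X' E hE.isFiniteLocallyFree 2 = κ 2 - d := by rw [hd_def, sub_sub_cancel]
    rw [hch, hκ2, map_add, map_add, map_sub, e.complexBetti_map_hom_map_inv]
    abel

/-- **The cell `(n, 2)` for the twisted door demands an UNTWISTED admissible complex** (PART Z-c's constant pencil + §2).
[cite: Bloch1972Semiregularity, Remark (7.5)] [cite: HuybrechtsStellari2005, §1] -/
theorem exists_untwisted_of_lefAtExceptionalRegimeAt_two {C : ChernCharacterBetti} {Adm : PerfectAdmissibility} {n : ℕ}
    (h : LefAtExceptionalRegimeAt (twistedReflexiveClass C Adm) n 2) (X : SchemeOver ℂ)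
    (hX : ∃ A : AbelianVariety ℂ, A.dim = n ∧ Nonempty (A.X ≅ X)) (w : complexBetti X (2 * 2)) (hwQ : IsRationalClass w)
    (hwalg : w ∈ algebraicClasses X 2) (hwD : w ∉ divisorClassesSpan X n 2) :
    ∃ (X' : SchemeOver ℂ) (e : X' ≅ X) (I : Finset ℕ) (E : CochainComplex X'.left.Modules ℤ) (hE : IsBoundedVBComplex E)
      (a : ℂ) (z' : complexBetti X (2 * 2)),
      2 ∈ I ∧ Adm n X' I E ∧ a ≠ 0 ∧ z' ∈ algebraicClasses X 2 ∧ z' ∈ divisorClassesSpan X n 2 ∧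
      chPerfect C X' E hE.isFiniteLocallyFree 2 = complexBetti.map e.hom (2 * 2) (a • w + z') :=
  exists_untwisted_of_designModLefschetzAt_two (designModLefschetzAt_of_lefAtExceptionalRegimeAt h) X hX w hwQ hwalg hwD

/-- **THE `(4,2)` STUB DEMANDS AN UNTWISTED CARRIER**: the registered stub `stub_firstCell_fourfoldMiddleTw`'s statement (regime 2 at `(4,2)`
over the road's twisted door, AdmTw = gluable σ-semiregular complexes ∨ a single Buchweitz–Flenner-semiregular vector bundle in degree `0`)
implies: for EVERY complex abelian fourfold `X` (up to a copy) and every rational algebraic `w ∉ D²(X) ⊗ ℂ` — e.g. a Weil class of a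
Picard-rank-one Weil-type fourfold, algebraic in print — an AdmTw-admissible bounded complex of vector bundles `E•` on a copy `e : X' ≅ X` with
`ch₂(E•) = e^*(a·w + z')`, `a ≠ 0`, `z'` an algebraic Lefschetz class. [cite: vanGeemen1994HodgeAV, Thm. 4.11] [cite: BuchweitzFlenner2003, §5 Thm. 5.1]
[cite: Bloch1972Semiregularity, Remark (7.5)] -/
theorem exists_untwisted_of_firstCell_fourfoldMiddleTw
    (h : ∀ C : ChernCharacterBetti, LefAtExceptionalRegimeAt (twistedReflexiveClass C
      (fun n X₀ I E => Summit.Ventures.HSemireg.gluableSigmaAdmissible n X₀ I E ∨ bfSingleAdmissible n X₀ I E)) 4 2)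
    (C : ChernCharacterBetti) (X : SchemeOver ℂ) (hX : ∃ A : AbelianVariety ℂ, A.dim = 4 ∧ Nonempty (A.X ≅ X))
    (w : complexBetti X (2 * 2)) (hwQ : IsRationalClass w) (hwalg : w ∈ algebraicClasses X 2) (hwD : w ∉ divisorClassesSpan X 4 2) :
    ∃ (X' : SchemeOver ℂ) (e : X' ≅ X) (I : Finset ℕ) (E : CochainComplex X'.left.Modules ℤ) (hE : IsBoundedVBComplex E)
      (a : ℂ) (z' : complexBetti X (2 * 2)),
      2 ∈ I ∧ (Summit.Ventures.HSemireg.gluableSigmaAdmissible 4 X' I E ∨ bfSingleAdmissible 4 X' I E) ∧ a ≠ 0 ∧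
      z' ∈ algebraicClasses X 2 ∧ z' ∈ divisorClassesSpan X 4 2 ∧
      chPerfect C X' E hE.isFiniteLocallyFree 2 = complexBetti.map e.hom (2 * 2) (a • w + z') :=
  exists_untwisted_of_lefAtExceptionalRegimeAt_two (h C) X hX w hwQ hwalg hwD

/-- **KILL SWITCH for the `(4,2)` stub, `B`-FIELD-FREE**: ONE Chern character theory `C`, ONE complex abelian fourfold `X` and ONE rational
algebraic class `w ∉ D²(X) ⊗ ℂ` such that NO copy of `X` carries an AdmTw-admissible bounded complex of vector bundles `E•` with
`ch₂(E•) ≡ e^*(a·w) (mod e^*(D² ⊗ ℂ))`, `a ≠ 0`, refute `stub_firstCell_fourfoldMiddleTw` (hence, through PART Z-d, trigger the crux's repair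
path — not a refutation of `HC_AV`). [cite: vanGeemen1994HodgeAV, Thm. 4.11] [cite: Bloch1972Semiregularity, Remark (7.5)] -/
theorem not_firstCell_fourfoldMiddleTw_of_no_untwisted (C : ChernCharacterBetti) (X : SchemeOver ℂ)
    (hX : ∃ A : AbelianVariety ℂ, A.dim = 4 ∧ Nonempty (A.X ≅ X)) (w : complexBetti X (2 * 2)) (hwQ : IsRationalClass w)
    (hwalg : w ∈ algebraicClasses X 2) (hwD : w ∉ divisorClassesSpan X 4 2)
    (hno : ∀ (X' : SchemeOver ℂ) (e : X' ≅ X) (I : Finset ℕ) (E : CochainComplex X'.left.Modules ℤ) (hE : IsBoundedVBComplex E)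
      (a : ℂ) (z' : complexBetti X (2 * 2)),
      2 ∈ I → (Summit.Ventures.HSemireg.gluableSigmaAdmissible 4 X' I E ∨ bfSingleAdmissible 4 X' I E) → a ≠ 0 →
      z' ∈ divisorClassesSpan X 4 2 → chPerfect C X' E hE.isFiniteLocallyFree 2 ≠ complexBetti.map e.hom (2 * 2) (a • w + z')) :
    ¬ ∀ C : ChernCharacterBetti, LefAtExceptionalRegimeAt (twistedReflexiveClass C
      (fun n X₀ I E => Summit.Ventures.HSemireg.gluableSigmaAdmissible n X₀ I E ∨ bfSingleAdmissible n X₀ I E)) 4 2 := by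
  intro h
  obtain ⟨X', e, I, E, hE, a, z', h2I, hAdm, ha, -, hzD, hch⟩ := exists_untwisted_of_firstCell_fourfoldMiddleTw h C X hX w hwQ hwalg hwD
  exact hno X' e I E hE a z' h2I hAdm ha hzD hch

/-! ## §3 Every degree: the `B`-field is invisible modulo Lefschetz classes wherever the lower Chern characters are Lefschetz
## (appended, ab-andre-2 gen 57) -/

/-- **`(exp B ∪ κ)_p ≡ κ_p (mod Dᵖ ⊗ ℂ)` as soon as `κ_j ∈ Dʲ ⊗ ℂ` for `j < p`** (and `B` is a rational `(1,1)`-class): the correction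
`Σ_{i ≥ 1} (1/i!) Bⁱ ∪ κ_{p-i}` is a sum of products `Dⁱ ∪ D^{p-i} ⊆ Dᵖ` (the complexified divisor ring is a ring,
`cupProduct_mem_divisorClassesSpan_of_mem`). [cite: HuybrechtsStellari2005, §1] [cite: vanGeemen1994HodgeAV, §2.4] -/
theorem expTwistClasses_sub_mem_divisorClassesSpan {N : ℕ} {X : SchemeOver ℂ} {B : complexBetti X 2}
    (hBQ : IsRationalClass B) (hBH : IsOfHodgeType N X 2 1 1 B) {κ : (j : ℕ) → complexBetti X (2 * j)} (p : ℕ)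
    (hκ : ∀ j < p, κ j ∈ divisorClassesSpan X N j) :
    expTwistClasses X B κ p - κ p ∈ divisorClassesSpan X N p := by
  unfold expTwistClasses
  rw [Fin.sum_univ_succ]
  have h0 : ((Nat.factorial ((0 : Fin (p + 1)) : ℕ) : ℕ) : ℂ)⁻¹ •
      cupProduct (two_mul_add_two_mul_sub (0 : Fin (p + 1)).2) (cupPowTwo B ((0 : Fin (p + 1)) : ℕ))
        (κ (p - ((0 : Fin (p + 1)) : ℕ))) = κ p := by
    show ((Nat.factorial 0 : ℕ) : ℂ)⁻¹ • cupProduct _ (cupPowTwo B 0) (κ (p - 0)) = κ p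
    rw [Nat.factorial_zero, Nat.cast_one, inv_one, one_smul, cupPowTwo_zero]
    exact one_cupProduct _
  rw [h0, add_sub_cancel_left]
  refine Submodule.sum_mem _ fun i _ ↦ Submodule.smul_mem _ _ ?_
  have hB : B ∈ Submodule.span ℂ {b : complexBetti X 2 | IsRationalClass b ∧ IsOfHodgeType N X 2 1 1 b} :=
    Submodule.subset_span ⟨hBQ, hBH⟩
  have hi : ((i.succ : Fin (p + 1)) : ℕ) = (i : ℕ) + 1 := Fin.val_succ i
  have hlt : p - ((i.succ : Fin (p + 1)) : ℕ) < p := by rw [hi]; omega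
  exact cupProduct_mem_divisorClassesSpan_of_mem (by rw [hi]; omega) _ (cupPowTwo_mem_divisorClassesSpan hB _) (hκ _ hlt)

/-- **For a member of the twisted door, `κ_p ≡ ch_p(E•) (mod Dᵖ ⊗ ℂ)` wherever the algebraic classes below codimension `p` are Lefschetz**:
on a smooth projective `X` with `Nʲ H²ʲ ⊆ Dʲ ⊗ ℂ` for `2 ≤ j < p` (for `j ≤ 1` this is `H⁰ = ℂ·1` and Lefschetz `(1,1)`; at `p = 3` it asks
`N² ⊆ D² ⊗ ℂ`, true for a very general Weil-type sixfold — `B² = D²`, van Geemen Thm. 6.12 — as a HYPOTHESIS here), a datum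
`twistedReflexiveClass C Adm n X I κ` with `p ∈ I` has an `Adm`-admissible bounded complex of vector bundles `E•` with `κ_p − ch_p(E•) ∈ Dᵖ(X) ⊗ ℂ`.
[cite: Perry2026Semiregularity, Thm. 1.1 (hypotheses)] [cite: vanGeemen1994HodgeAV, §2.4 and Thm. 6.12] [cite: Fulton1998, Example 3.2.3] -/
theorem kappa_sub_chPerfect_mem_divisorClassesSpan {C : ChernCharacterBetti} {Adm : PerfectAdmissibility} {n N : ℕ}
    {X : SchemeOver ℂ} (hX : IsSmoothProjective N X) {p : ℕ}
    (hN : ∀ j, 2 ≤ j → j < p → algebraicClasses X j ≤ divisorClassesSpan X N j)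
    {I : Finset ℕ} {κ : (q : ℕ) → complexBetti X (2 * q)} (h : twistedReflexiveClass C Adm n X I κ) (hp : p ∈ I) :
    ∃ (E : CochainComplex X.left.Modules ℤ) (hE : IsBoundedVBComplex E),
      Adm n X I E ∧ κ p - chPerfect C X E hE.isFiniteLocallyFree p ∈ divisorClassesSpan X N p := by
  obtain ⟨E, hE, B₀, hAdm, hBQ, hBalg, hκ⟩ := h
  refine ⟨E, hE, hAdm, ?_⟩
  rw [hκ p hp]
  refine expTwistClasses_sub_mem_divisorClassesSpan hBQ (isOfHodgeType_of_mem_algebraicClasses_of_isSmoothProjective hX 1 hBalg) p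
    fun j hj ↦ ?_
  rcases Nat.lt_or_ge j 2 with hj2 | hj2
  · interval_cases j
    · -- `ch₀ ∈ ℂ·1 = D⁰ ⊗ ℂ`
      obtain ⟨c, hc⟩ := exists_eq_smul_one_of_isSmoothProjective hX ℂ (chPerfect C X E hE.isFiniteLocallyFree 0)
      rw [hc]
      exact Submodule.smul_mem _ _ (Submodule.subset_span (Literature.Barriers.HodgeConjecture.mem_divisorMonomials_zero.2 rfl))
    · -- `ch₁` is a rational `(1,1)`-class
      have h1 : cupProduct (show 2 * 0 + 2 = 2 * (0 + 1) by ring) (singularCohomology.one ℂ (ComplexPoints X))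
          (chPerfect C X E hE.isFiniteLocallyFree 1) ∈ divisorMonomials X N (0 + 1) :=
        Literature.Barriers.HodgeConjecture.mem_divisorMonomials_one (isRationalClass_chPerfect C X E hE.isFiniteLocallyFree 1)
          (isOfHodgeType_of_mem_algebraicClasses_of_isSmoothProjective hX 1
            (chPerfect_mem_algebraicClasses C X hX E hE.isFiniteLocallyFree 1))
      rw [one_cupProduct] at h1
      exact Submodule.subset_span h1
  · exact hN j hj2 hj (chPerfect_mem_algebraicClasses C X hX E hE.isFiniteLocallyFree j)

/-- **`DesignModLefschetzAt (twistedReflexiveClass C Adm) n p` in UNTWISTED form at varieties whose algebraic classes below codimension `p` are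
Lefschetz**: for `(X, w)` as there with `Nʲ(X) ⊆ Dʲ(X) ⊗ ℂ` for `2 ≤ j < p`, some copy `e : X' ≅ X` carries an `Adm`-admissible bounded complex of
vector bundles `E•` with `ch_p(E•) = e^*(a·w + z')`, `a ≠ 0`, `z'` an algebraic Lefschetz class (the hypothesis transports to the copy along `e`).
[cite: HuybrechtsStellari2005, §1] [cite: vanGeemen1994HodgeAV, §2.4 and Thm. 6.12] [cite: Bloch1972Semiregularity, Remark (7.5)] -/
theorem exists_untwisted_of_designModLefschetzAt_of_algebraicClasses_le {C : ChernCharacterBetti} {Adm : PerfectAdmissibility} {n p : ℕ}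
    (h : DesignModLefschetzAt (twistedReflexiveClass C Adm) n p) (X : SchemeOver ℂ)
    (hX : ∃ A : AbelianVariety ℂ, A.dim = n ∧ Nonempty (A.X ≅ X))
    (hN : ∀ j, 2 ≤ j → j < p → algebraicClasses X j ≤ divisorClassesSpan X n j)
    (w : complexBetti X (2 * p)) (hwQ : IsRationalClass w) (hwalg : w ∈ algebraicClasses X p) (hwD : w ∉ divisorClassesSpan X n p) :
    ∃ (X' : SchemeOver ℂ) (e : X' ≅ X) (I : Finset ℕ) (E : CochainComplex X'.left.Modules ℤ) (hE : IsBoundedVBComplex E)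
      (a : ℂ) (z' : complexBetti X (2 * p)),
      p ∈ I ∧ Adm n X' I E ∧ a ≠ 0 ∧ z' ∈ algebraicClasses X p ∧ z' ∈ divisorClassesSpan X n p ∧
      chPerfect C X' E hE.isFiniteLocallyFree p = complexBetti.map e.hom (2 * p) (a • w + z') := by
  obtain ⟨A, hA, ⟨eA⟩⟩ := hX
  have hAX : IsSmoothProjective n A.X := hA ▸ AbelianVariety.isSmoothProjective_holds (A := A)
  have hXsp : IsSmoothProjective n X := hAX.of_iso eA
  obtain ⟨X', e, I, κ, a, z, hpI, h𝒪, ha, hzalg, hzD, hκp, -⟩ := h X ⟨A, hA, ⟨eA⟩⟩ w hwQ hwalg hwD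
  have hX'sp : IsSmoothProjective n X' := hXsp.of_iso e.symm
  -- the hypothesis on the copy
  have hN' : ∀ j, 2 ≤ j → j < p → algebraicClasses X' j ≤ divisorClassesSpan X' n j := by
    intro j hj2 hjp c hc
    have hc' : complexBetti.map e.inv (2 * j) c ∈ algebraicClasses X j := (mem_algebraicClasses_map_iff_of_iso e.symm).2 hc
    have hback := map_mem_divisorClassesSpan hX'sp hXsp e.hom (hN j hj2 hjp hc')
    rwa [e.complexBetti_map_hom_map_inv] at hback
  obtain ⟨E, hE, hAdm, hd⟩ := kappa_sub_chPerfect_mem_divisorClassesSpan hX'sp hN' h𝒪 hpI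
  set d := κ p - chPerfect C X' E hE.isFiniteLocallyFree p with hd_def
  have hdX : complexBetti.map e.inv (2 * p) d ∈ divisorClassesSpan X n p := map_mem_divisorClassesSpan hXsp hX'sp e.inv hd
  refine ⟨X', e, I, E, hE, a, z - complexBetti.map e.inv (2 * p) d, hpI, hAdm, ha, ?_, Submodule.sub_mem _ hzD hdX, ?_⟩
  · exact Submodule.sub_mem _ hzalg (divisorClassesSpan_le_algebraicClasses_of_isSmoothProjective hXsp p hdX)
  · have hch : chPerfect C X' E hE.isFiniteLocallyFree p = κ p - d := by rw [hd_def, sub_sub_cancel]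
    rw [hch, hκp, map_add, map_add, map_sub, e.complexBetti_map_hom_map_inv]
    abel

/-- **THE `(6,3)` RUNG AT A VERY GENERAL WEIL-TYPE SIXFOLD DEMANDS AN UNTWISTED, PINNED CARRIER**: for every complex abelian sixfold `X` (up to
a copy) with `B¹(X) = ℚ·θ` in Hodge form AND `N²(X) ⊆ D²(X) ⊗ ℂ` (both hold at a very general member of any Weil component — as HYPOTHESES
here) and every rational ALGEBRAIC `w ∉ ℂ·θ³` (a Weil class), the rung `stub_rung_sixfoldMiddleTw` (door `twistedReflexiveClass C AdmTw`) forces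
an AdmTw-admissible bounded complex of vector bundles `E•` on a copy `e : X' ≅ X` with `ch₃(E•) = e^*(a·w + c·θ³)`, `a ≠ 0` — no `B`-field, no
Lefschetz slack beyond `ℂ·θ³`. Print has NO such complex on any very general Weil sixfold (Markman's secant sheaves live on the anchor `X × X̂`).
[cite: vanGeemen1994HodgeAV, Thm. 4.11 and Thm. 6.12] [cite: Markman2025SecantWeil, Thm. 1.4.1] [cite: Bloch1972Semiregularity, Remark (7.5)] -/
theorem exists_untwisted_pinned_sixfold_of_rung_sixfoldMiddleTw
    (h : ∀ C : ChernCharacterBetti, LefAtExceptionalRegimeSixfoldMiddle (twistedReflexiveClass C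
      (fun n X₀ I E => Summit.Ventures.HSemireg.gluableSigmaAdmissible n X₀ I E ∨ bfSingleAdmissible n X₀ I E)))
    (C : ChernCharacterBetti) (X : SchemeOver ℂ) (hX : ∃ A : AbelianVariety ℂ, A.dim = 6 ∧ Nonempty (A.X ≅ X)) (θ : complexBetti X 2)
    (hpic : ∀ b : complexBetti X 2, IsRationalClass b → IsOfHodgeType 6 X 2 1 1 b → b ∈ ℂ ∙ θ)
    (hN2 : algebraicClasses X 2 ≤ divisorClassesSpan X 6 2)
    (w : complexBetti X (2 * 3)) (hwQ : IsRationalClass w) (hwalg : w ∈ algebraicClasses X 3) (hw : w ∉ ℂ ∙ cupPowTwo θ 3) :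
    ∃ (X' : SchemeOver ℂ) (e : X' ≅ X) (I : Finset ℕ) (E : CochainComplex X'.left.Modules ℤ) (hE : IsBoundedVBComplex E) (a c : ℂ),
      3 ∈ I ∧ (Summit.Ventures.HSemireg.gluableSigmaAdmissible 6 X' I E ∨ bfSingleAdmissible 6 X' I E) ∧ a ≠ 0 ∧
      chPerfect C X' E hE.isFiniteLocallyFree 3 = complexBetti.map e.hom (2 * 3) (a • w + c • cupPowTwo θ 3) := by
  have hD : divisorClassesSpan X 6 3 ≤ ℂ ∙ cupPowTwo θ 3 := divisorClassesSpan_le_span_cupPowTwo hpic 3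
  have hwD : w ∉ divisorClassesSpan X 6 3 := fun hw' ↦ hw (hD hw')
  have hcell : LefAtExceptionalRegimeAt (twistedReflexiveClass C
      (fun n X₀ I E => Summit.Ventures.HSemireg.gluableSigmaAdmissible n X₀ I E ∨ bfSingleAdmissible n X₀ I E)) 6 3 :=
    lefAtExceptionalRegimeSixfoldMiddle_iff_at.1 (h C)
  obtain ⟨X', e, I, E, hE, a, z', h3I, hAdm, ha, -, hzD, hch⟩ :=
    exists_untwisted_of_designModLefschetzAt_of_algebraicClasses_le (designModLefschetzAt_of_lefAtExceptionalRegimeAt hcell) X hX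
      (fun j hj2 hj3 ↦ by interval_cases j; exact hN2) w hwQ hwalg hwD
  obtain ⟨c, hc⟩ := Submodule.mem_span_singleton.1 (hD hzD)
  exact ⟨X', e, I, E, hE, a, c, h3I, hAdm, ha, by rw [hch, ← hc]⟩

end Summit.HodgeConjecture.HodgeConjecture.Ring2.SemiregularRepresentatives

end
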